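import Summits.AtomisticToContinuum.Crystallization.Theorems.ThreeConeCertificateSlackRigidityPricedFloorsMeasurability
import Summits.AtomisticToContinuum.Crystallization.Theorems.ThreeConeCertificateSlackRigidityPricedFloorsEmbedding

/-!
# `SlackRigidity` (stmt-AtomisticToContinuum-11960), line `priced-floors-palm-exactification`:
# measurability of layer functionals, II — transfer to measures and the joint version

Continuation of `…PricedFloorsMeasurability` (S3 measurability package for
`stub_layeredMeanSelection`):

* `lms_exists_measurable_dataSup` — the third registered sub-goal: for a continuous data
  functional `φ`, the Borel functional `S ↦ dataSup φ ↑S` of rooted `δ`-hard-core configurations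
  (`lms_measurable_dataSup`) extends by `0` to a Giry-measurable functional `F` of measures on
  `ℝ³` with `F (count|S) = dataSup φ ↑S`, through the measurable embedding `S ↦ count|S`
  (`stub_toMeasureEmbedding`, `MeasurableEmbedding.measurable_extend`).
* `lms_measurable_dataSup_joint` — the JOINT, point-dependent version for functionals
  `φ : LData × E3 → ℝ` that are only upper semicontinuous on (normal data) `× ℝ³` (closed
  super-level sets): `(S, y) ↦ sup {φ (e, y) | e fits ↑S}` is Borel on (configurations) `× ℝ³` —
  the super-level set `{c ≤ sup}` is the projection along the COMPACT normal-data factor (a closed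
  map, `isClosedMap_fst_of_compactSpace`) of the closed set `{fits} ∩ {c ≤ φ}` (an u.s.c. function
  attains its supremum on the compact nonempty fitting set, `UpperSemicontinuousOn.exists_isMaxOn`),
  united with `{nothing fits} ∩ {c ≤ 0}` — and it transfers to a measurable functional of
  (measure, point) through the measurable embedding `(S, y) ↦ (count|S, y)`
  (`MeasurableEmbedding.prodMap`).

No definitions.  All `[folklore]`.
-/

noncomputable section

open MeasureTheory Filter Set Topology

namespace Summit.AtomisticToContinuum.Crystallization.Theorems.SlackRigidityPricedFloorsMeasurability

open Literature.Probability.Process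
open Literature.MathematicalPhysics.StatisticalMechanics
open Summit.AtomisticToContinuum.Crystallization.Theorems.SlackRigidityPricedFloors

/-! ## Sub-goal (3): transfer to a Giry-measurable functional of configurations-as-measures -/

/-- Transfer through a measurable embedding: any measurable functional of rooted hard-core
configurations extends to a measurable functional of measures. [folklore] -/
theorem exists_measurable_extend {δ : ℝ} [Fact (0 < δ)]
    (hemb : MeasurableEmbedding
      (fun S : LocalConfig.RootedHardCoreConfig E3 δ => (S.1 : LocalConfig E3).toMeasure))
    {g : LocalConfig.RootedHardCoreConfig E3 δ → ℝ} (hg : Measurable g) :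
    ∃ F : Measure E3 → ℝ, Measurable F ∧
      ∀ S : LocalConfig.RootedHardCoreConfig E3 δ, F ((S.1 : LocalConfig E3).toMeasure) = g S :=
  ⟨Function.extend
      (fun S : LocalConfig.RootedHardCoreConfig E3 δ => (S.1 : LocalConfig E3).toMeasure) g
      (fun _ => 0),
    hemb.measurable_extend hg measurable_const, fun S => hemb.injective.extend_apply _ _ S⟩

/-- **Sub-goal `lms_exists_measurable_dataSup`.** For a continuous data functional `φ` there is a
Giry-measurable functional `F` of measures on `ℝ³` with `F (count|S) = dataSup φ ↑S` for every
rooted `δ`-hard-core configuration `S`: extend the Borel functional of `lms_measurable_dataSup` by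
`0` through the measurable embedding `S ↦ count|S` (`stub_toMeasureEmbedding`). [folklore] -/
theorem lms_exists_measurable_dataSup : ∀ (δ : ℝ) [Fact (0 < δ)] (φ : LData → ℝ), Continuous φ → ∃ F : Measure E3 → ℝ, Measurable F ∧ ∀ S : LocalConfig.RootedHardCoreConfig E3 δ, F ((S.1 : LocalConfig E3).toMeasure) = dataSup φ ((S.1 : LocalConfig E3) : Set E3) :=
  fun δ _ φ hφ =>
    exists_measurable_extend (SlackRigidityPricedFloorsEmbedding.stub_toMeasureEmbedding δ)
      (lms_measurable_dataSup δ φ hφ)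

/-! ## Joint version: point-dependent, upper semicontinuous data functionals -/

/-- **Joint measurability (u.s.c. functionals depending on a space point).**  For
`φ : LData × E3 → ℝ` upper semicontinuous on (normal data) `×` `ℝ³` (closed super-level sets), the
map `(S, y) ↦ sup {φ (e, y) | e fits ↑S}` (`= dataSup (φ (·, y)) ↑S`) is Borel on (rooted
`δ`-hard-core configurations) `× ℝ³`: the super-level set `{c ≤ sup}` is the projection along the
COMPACT normal-data factor (a closed map, `isClosedMap_fst_of_compactSpace`) of the closed set
`{fits} ∩ {c ≤ φ}` (an u.s.c. function attains its supremum on the compact nonempty fitting set),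
united with `{nothing fits} ∩ {c ≤ 0}`; and it transfers to a measurable functional of
(measure, point) agreeing at `(count|S, y)` through the measurable embedding
`(S, y) ↦ (count|S, y)` (`stub_toMeasureEmbedding`, `MeasurableEmbedding.prodMap`). [folklore] -/
theorem lms_measurable_dataSup_joint : ∀ (δ : ℝ) [Fact (0 < δ)] (φ : LData × E3 → ℝ), (∀ c : ℝ, IsClosed {x : {e : LData // IsNormalData e} × E3 | c ≤ φ (x.1.1, x.2)}) → Measurable (fun p : LocalConfig.RootedHardCoreConfig E3 δ × E3 => sSup ((fun e => φ (e, p.2)) '' {e | Fits ((p.1.1 : LocalConfig E3) : Set E3) e})) ∧ ∃ F : Measure E3 × E3 → ℝ, Measurable F ∧ ∀ (S : LocalConfig.RootedHardCoreConfig E3 δ) (y : E3), F ((S.1 : LocalConfig E3).toMeasure, y) = sSup ((fun e => φ (e, y)) '' {e | Fits ((S.1 : LocalConfig E3) : Set E3) e}) := by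
  intro δ _ φ hφ
  haveI : CompactSpace {e : LData // IsNormalData e} :=
    isCompact_iff_compactSpace.1 isCompact_setOf_isNormalData
  -- `φ (·, y)` is upper semicontinuous on the normal data
  have hψ : ∀ y : E3, UpperSemicontinuous fun e : {e : LData // IsNormalData e} => φ (e.1, y) :=
    fun y => upperSemicontinuous_iff_isClosed_preimage.2 fun c =>
      (hφ c).preimage (continuous_id.prodMk continuous_const)
  -- the fitting relation and the super-level sets, pulled back to `(config × point) × data`
  set A : Set ((LocalConfig.RootedHardCoreConfig E3 δ × E3) × {e : LData // IsNormalData e}) :=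
    {q | Fits ((q.1.1.1 : LocalConfig E3) : Set E3) (q.2 : LData)}
  have hA : IsClosed A := (lms_isClosed_fits δ).preimage
    ((continuous_fst.comp continuous_fst).prodMk (continuous_subtype_val.comp continuous_snd))
  have hB : ∀ c : ℝ, IsClosed {q : (LocalConfig.RootedHardCoreConfig E3 δ × E3) ×
      {e : LData // IsNormalData e} | c ≤ φ ((q.2 : LData), q.1.2)} := fun c =>
    (hφ c).preimage (continuous_snd.prodMk (continuous_snd.comp continuous_fst))
  have hT : ∀ S : LocalConfig.RootedHardCoreConfig E3 δ,
      IsCompact {e : {e : LData // IsNormalData e} | Fits ((S.1 : LocalConfig E3) : Set E3) e.1} :=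
    fun S =>
      ((lms_isClosed_fits δ).preimage (continuous_const.prodMk continuous_subtype_val)).isCompact
  have hmeas : Measurable (fun p : LocalConfig.RootedHardCoreConfig E3 δ × E3 =>
      sSup ((fun e => φ (e, p.2)) '' {e | Fits ((p.1.1 : LocalConfig E3) : Set E3) e})) := by
    refine measurable_of_Ici fun c => ?_
    have key : (fun p : LocalConfig.RootedHardCoreConfig E3 δ × E3 =>
        sSup ((fun e => φ (e, p.2)) '' {e | Fits ((p.1.1 : LocalConfig E3) : Set E3) e})) ⁻¹'
          Ici c = Prod.fst '' (A ∩ {q | c ≤ φ ((q.2 : LData), q.1.2)}) ∪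
          ((Prod.fst '' A)ᶜ ∩ {_p | c ≤ 0}) := by
      ext ⟨S, y⟩
      rw [mem_preimage, mem_Ici, mem_union, mem_inter_iff, mem_compl_iff]
      have hPiff : (S, y) ∈ Prod.fst '' (A ∩ {q | c ≤ φ ((q.2 : LData), q.1.2)}) ↔
          ∃ e, Fits ((S.1 : LocalConfig E3) : Set E3) e ∧ c ≤ φ (e, y) := by
        constructor
        · rintro ⟨⟨⟨S', y'⟩, e⟩, ⟨h1, h2⟩, h3⟩
          obtain ⟨rfl, rfl⟩ := Prod.mk.inj h3
          exact ⟨e, h1, h2⟩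
        · rintro ⟨e, h1, h2⟩
          exact ⟨((S, y), ⟨e, h1.1⟩), ⟨h1, h2⟩, rfl⟩
      have hGiff : (S, y) ∈ Prod.fst '' A ↔ ∃ e, Fits ((S.1 : LocalConfig E3) : Set E3) e := by
        constructor
        · rintro ⟨⟨⟨S', y'⟩, e⟩, h1, h3⟩
          obtain ⟨rfl, rfl⟩ := Prod.mk.inj h3
          exact ⟨e, h1⟩
        · rintro ⟨e, h1⟩
          exact ⟨((S, y), ⟨e, h1.1⟩), h1, rfl⟩
      rw [hPiff, hGiff, mem_setOf_eq]
      rcases ({e : LData | Fits ((S.1 : LocalConfig E3) : Set E3) e}).eq_empty_or_nonempty with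
        h0 | ⟨e₀, he₀⟩
      · have hno : ¬ ∃ e, Fits ((S.1 : LocalConfig E3) : Set E3) e := by
          rintro ⟨e, he⟩
          have : e ∈ ({e : LData | Fits ((S.1 : LocalConfig E3) : Set E3) e}) := he
          rw [h0] at this
          exact this
        rw [show (fun e => φ (e, y)) '' {e | Fits ((S.1 : LocalConfig E3) : Set E3) e} = ∅ by
          rw [h0, image_empty], Real.sSup_empty]
        constructor
        · exact fun hc => Or.inr ⟨hno, hc⟩
        · rintro (⟨e, he, -⟩ | ⟨-, hc⟩)
          · exact absurd ⟨e, he⟩ hno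
          · exact hc
      · obtain ⟨e₁, he₁, hmax⟩ := ((hψ y).upperSemicontinuousOn _).exists_isMaxOn
          ⟨⟨e₀, he₀.1⟩, he₀⟩ (hT S)
        have hgr : IsGreatest
            ((fun e => φ (e, y)) '' {e | Fits ((S.1 : LocalConfig E3) : Set E3) e})
            (φ ((e₁ : LData), y)) :=
          ⟨⟨e₁, he₁, rfl⟩, by
            rintro _ ⟨e, he, rfl⟩
            exact (isMaxOn_iff.1 hmax) ⟨e, he.1⟩ he⟩
        rw [hgr.csSup_eq]
        constructor
        · exact fun hc => Or.inl ⟨e₁, he₁, hc⟩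
        · rintro (⟨e, he, hce⟩ | ⟨hno, -⟩)
          · exact hce.trans (hgr.2 ⟨e, he, rfl⟩)
          · exact absurd ⟨e₀, he₀⟩ hno
    rw [key]
    exact ((isClosedMap_fst_of_compactSpace _ (hA.inter (hB c))).measurableSet).union
      ((isClosedMap_fst_of_compactSpace _ hA).measurableSet.compl.inter (MeasurableSet.const _))
  refine ⟨hmeas, ?_⟩
  have hemb : MeasurableEmbedding (Prod.map
      (fun S : LocalConfig.RootedHardCoreConfig E3 δ => (S.1 : LocalConfig E3).toMeasure)
      (id : E3 → E3)) :=
    (SlackRigidityPricedFloorsEmbedding.stub_toMeasureEmbedding δ).prodMap MeasurableEmbedding.id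
  exact ⟨Function.extend (Prod.map
      (fun S : LocalConfig.RootedHardCoreConfig E3 δ => (S.1 : LocalConfig E3).toMeasure) id)
      (fun p => sSup ((fun e => φ (e, p.2)) '' {e | Fits ((p.1.1 : LocalConfig E3) : Set E3) e}))
      (fun _ => 0),
    hemb.measurable_extend hmeas measurable_const,
    fun S y => hemb.injective.extend_apply _ _ (S, y)⟩

end Summit.AtomisticToContinuum.Crystallization.Theorems.SlackRigidityPricedFloorsMeasurability

end
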